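import Literature.Computability.AlgebraicComplexity.FSV2018ROABP
import Literature.Computability.AlgebraicComplexity.FSV18SparseHittingProofs
import Literature.Computability.AlgebraicComplexity.FSV18Thm9AssemblyR1
import Literature.Computability.AlgebraicComplexity.FSV18Lemma53Reduction
import Literature.LinearAlgebra.Matrix.RankMinors
import HarnessLib

/-!
# FSV Lemma 53 (ToC Lemma 6.4, hitting half) from Fact 51 [BMS13] and Lemma 52 [ASSS16] — the
# printed proof of §6 (val-lit t18 g2; N1 support)

Forbes–Shpilka–Volk, *Succinct hitting sets and barriers to proving lower bounds for algebraic
circuits*, Theory of Computing 14(18) (2018) = arXiv:1701.05328, §6. The cell's named fact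
`ForbesShpilkaVolk2018_lemma53` (`FSV2018ROABP.lean`, val-lit t21: the generator
`𝒢^{BMS}_{r,s} = 𝒢^{RC}_{n,r} + 𝒢^{SSSV}_{n,m}`, `m = r⌈log s⌉ + r⌈log r⌉`, hits every
`C(F_1, …, F_M)` with `s`-sparse `F_i` of degree `≤ d` and `trdeg ≤ r`, when `char 𝔽 = 0` or
`char 𝔽 > d^r`) is the one FSV-INTERNAL member of the conditional set under the LOAD-BEARING
`FSV2018_thm9` (`FSV2018_thm9_of_R1facts`). Its printed proof is one paragraph (PDF p. 28):

> *Proof.* By Lemma 6.3 [= seq. Lemma 52] and Proposition 4.2 [= seq. Prop. 17], it is enough to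
> show that the map `𝒢^{SSSV}_{n,m}(w, z)` preserves the rank of the Jacobian matrix. This follows
> from the fact that each `r × r` minor of this matrix is a polynomial of sparsity at most `r!·s^r`
> (since taking derivatives can only decrease the sparsity), and from Corollary 5.10 [= seq. Cor. 34].

This file carries that paragraph out in the kernel, so that Lemma 53 hangs on the two EXTERNAL
printed results it quotes, both already typed as named facts with cite tags in `FSV2018ROABP.lean`:

* `ForbesShpilkaVolk2018_fact51` — the Jacobian criterion [BMS13] (rank of the Jacobian = trdeg,
  `char = 0` or `char > d^r`, the corrected strict form): used, as print does implicitly ("each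
  `r × r` minor"), to know that the Jacobian rank is the transcendence degree `≤ r`, so that the
  relevant minors have sparsity `≤ r!·s^r ≤ 2^m`;
* `ForbesShpilkaVolk2018_lemma52` — the faithful-homomorphism recipe [ASSS16]
  (`X_i ↦ Σ_j s_j t^{ij} + Φ(X_i)` preserves non-zeroness of `C(F_1, …, F_M)` whenever `Φ`
  preserves the Jacobian rank).

## Structure (mirrors the printed paragraph)

* § Sparsity: "taking derivatives can only decrease the sparsity" (`card_support_pderiv_le`) and
  "each `k × k` minor … has sparsity at most `k!·s^k`" (`card_support_det_le`), plus the seed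
  arithmetic `k!·s^k ≤ 2^{r⌈log₂ s⌉ + r⌈log₂ r⌉}` for `k ≤ r` (`factorial_mul_pow_le_two_pow_bmsK`).
* § Rank: a ring map that kills no non-vanishing minor of size `≤ rank` preserves the rank
  (`rank_map_eq_of_map_minors_ne_zero`, from the tree's rank-by-minors file
  `Literature/LinearAlgebra/Matrix/RankMinors.lean`).
* § Index: the binary enumeration `binaryOrder n` of the `N = 2ⁿ` coordinates (val-lit t21) has
  `binIndex = index + 1`, so that Lemma 52's Vandermonde block `Σ_j s_j t^{ij}` is Prop. 17's
  `vdmGenCoeff` (`binIndex_binaryOrder`).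
* § Main: `ForbesShpilkaVolk2018_lemma53_of_fact51_of_lemma52`. Cor. 34 enters BY NAME as the
  tree's theorem `ForbesShpilkaVolk2018_svGeneratorHitsSparse_holds` (val-lit t19), Prop. 17 as
  `bind₁_binaryPowersSubst_rcGenCoeff` (val-lit t18).
* § Assembly: `FSV2018_thm9_of_externalFacts` — the LOAD-BEARING `FSV2018_thm9` from EXTERNAL
  printed results only: Fact 19 [SY10/SS], Lemma 23 [BMS13/ASSS16], Lemma 36 [Forbes15], Lemma 40
  [FSS14], Thm. 48 [ASSS16], Fact 51 [BMS13], Lemma 52 [ASSS16]; and `FSV2018_thm9_of_sixExternalFacts`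
  — the same WITHOUT Fact 51, through the parallel reduction `ForbesShpilkaVolk2018_lemma53_of_lemma52`
  of `FSV18Lemma53Reduction.lean` (val-lit t21 g2, landed the same hour), which proves the inequality
  `rank Jac ≤ trdeg` in every characteristic instead of quoting Fact 51. (The two files are
  independent kernel checks of the same printed paragraph; this one follows print in using the
  Jacobian criterion for `rank = trdeg`.)

No definitions, no new named facts (proof-only file). Honest framing: this re-bases one printed
lemma on the printed external results its proof quotes; `VP ≠ VNP` is NOT proved and nothing here
is progress on it.

## References
* [ForbesShpilkaVolk2018] M. A. Forbes, A. Shpilka, B. L. Volk, *Succinct hitting sets and barriers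
  to proving lower bounds for algebraic circuits*, Theory Comput. 14(18) (2018) 1–45,
  arXiv:1701.05328: §6, Fact 6.2 / Lemma 6.3 / Lemma 6.4 (= seq. Fact 51 / Lemma 52 / Lemma 53),
  Prop. 4.2 (= seq. Prop. 17), Cor. 5.10 (= seq. Cor. 34).
  locator: HOME/lit/pdftxt/FSV2018/p027.txt:L43–p028.txt:L36 (arXiv PDF pp. 27–28: §6; Lemma 6.4 =
  p028.txt:L17–L27, its proof = p028.txt:L28–L32); HOME/lit/pdftxt/FSV2018-ToC/p031.txt:L29–L45
* [BMS13] M. Beecken, J. Mittmann, N. Saxena, *Algebraic independence and blackbox identity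
  testing*, Inform. and Comput. 222 (2013) — the Jacobian criterion (Fact 51).
* [ASSS16] M. Agrawal, C. Saha, R. Saptharishi, N. Saxena, *Jacobian hits circuits…*, SIAM J.
  Comput. 45(4) (2016) — the faithful-homomorphism recipe (Lemma 52).
-/

noncomputable section

namespace Literature.Computability.AlgebraicComplexity

open MvPolynomial Finset

namespace FSV18Lemma53

/-! ### Sparsity: "taking derivatives can only decrease the sparsity"; minors of sparse matrices -/

section Sparsity

variable {R : Type*} [CommRing R] {σ : Type*}

/-- `∂/∂x_i` does not increase the number of monomials ("taking derivatives can only decrease the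
sparsity"). [cite: ForbesShpilkaVolk2018, proof of Lemma 53 (seq.) = ToC Lemma 6.4, p. 31]
locator: HOME/lit/pdftxt/FSV2018/p028.txt:L30–L31 -/
theorem card_support_pderiv_le (i : σ) (p : MvPolynomial σ R) :
    (pderiv i p).support.card ≤ p.support.card := by
  classical
  refine Finset.card_le_card_of_injOn (fun m => m + Finsupp.single i 1) ?_ ?_
  · intro m hm
    have hm' : coeff m (pderiv i p) ≠ 0 := by simpa [mem_support_iff] using hm
    rw [coeff_pderiv] at hm'
    simpa [mem_support_iff] using left_ne_zero_of_mul hm'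
  · intro a _ b _ h
    exact add_right_cancel h

/-- Sparsity is sub-multiplicative. [folklore] -/
private theorem card_support_mul_le (p q : MvPolynomial σ R) :
    (p * q).support.card ≤ p.support.card * q.support.card := by
  classical
  exact (Finset.card_le_card (support_mul p q)).trans Finset.card_add_le

/-- Scaling by a constant does not increase the sparsity. [folklore] -/
private theorem card_support_C_mul_le (a : R) (p : MvPolynomial σ R) :
    (C a * p).support.card ≤ p.support.card := by
  classical
  rw [C_mul']
  exact Finset.card_le_card support_smul

/-- A product of `|s|` polynomials with at most `b` monomials each has at most `b^{|s|}` monomials.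
[folklore] -/
private theorem card_support_prod_le {ι : Type*} (s : Finset ι) (f : ι → MvPolynomial σ R) (b : ℕ)
    (h : ∀ i ∈ s, (f i).support.card ≤ b) : (∏ i ∈ s, f i).support.card ≤ b ^ s.card := by
  classical
  induction s using Finset.induction_on with
  | empty =>
    rw [Finset.prod_empty, Finset.card_empty, pow_zero]
    have h1 : (1 : MvPolynomial σ R) = monomial 0 1 := rfl
    rw [h1]
    exact (Finset.card_le_card support_monomial_subset).trans (by simp)
  | insert a s ha ih =>
    rw [Finset.prod_insert ha, Finset.card_insert_of_notMem ha, pow_succ']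
    exact (card_support_mul_le _ _).trans (Nat.mul_le_mul (h a (Finset.mem_insert_self a s))
      (ih fun i hi => h i (Finset.mem_insert_of_mem hi)))

/-- Sparsity is sub-additive over finite sums. [folklore] -/
private theorem card_support_sum_le {ι : Type*} (s : Finset ι) (f : ι → MvPolynomial σ R) :
    (∑ i ∈ s, f i).support.card ≤ ∑ i ∈ s, (f i).support.card := by
  classical
  induction s using Finset.induction_on with
  | empty => simp
  | insert a s ha ih =>
    rw [Finset.sum_insert ha, Finset.sum_insert ha]
    exact (Finset.card_le_card support_add).trans
      ((Finset.card_union_le _ _).trans (Nat.add_le_add_left ih _))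

/-- **"Each `k × k` minor of this matrix is a polynomial of sparsity at most `k!·s^k`":** the
determinant of a `k × k` matrix whose entries have at most `b` monomials each has at most `k!·b^k`
monomials (Leibniz expansion). [cite: ForbesShpilkaVolk2018, proof of Lemma 53 (seq.) = ToC Lemma 6.4, p. 31]
locator: HOME/lit/pdftxt/FSV2018/p028.txt:L30–L31 -/
theorem card_support_det_le {k : ℕ} (A : Matrix (Fin k) (Fin k) (MvPolynomial σ R)) (b : ℕ)
    (h : ∀ i j, (A i j).support.card ≤ b) : A.det.support.card ≤ k.factorial * b ^ k := by
  classical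
  rw [Matrix.det_apply']
  refine (card_support_sum_le _ _).trans ?_
  have hterm : ∀ τ : Equiv.Perm (Fin k),
      ((((Equiv.Perm.sign τ : ℤˣ) : ℤ) : MvPolynomial σ R) * ∏ i, A (τ i) i).support.card ≤
        b ^ k := by
    intro τ
    rw [← map_intCast (C : R →+* MvPolynomial σ R)]
    refine (card_support_C_mul_le _ _).trans ?_
    refine (card_support_prod_le _ _ b fun i _ => h _ _).trans ?_
    rw [Finset.card_univ, Fintype.card_fin]
  refine (Finset.sum_le_sum fun τ _ => hterm τ).trans ?_
  rw [Finset.sum_const, smul_eq_mul, Finset.card_univ, Fintype.card_perm, Fintype.card_fin]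

/-- Seed arithmetic for Lemma 53: for `k ≤ r`, `k!·s^k ≤ 2^{r⌈log₂ s⌉ + r⌈log₂ r⌉} = 2^{bmsK r s}`
(`k! ≤ r^r ≤ 2^{r⌈log₂ r⌉}`, `s^k ≤ 2^{k⌈log₂ s⌉}`), i.e. `m = r log s + r log r` seed blocks of
the shifted SV generator suffice for sparsity `r!·s^r` (Cor. 34 needs `sparsity ≤ 2^m`).
[cite: ForbesShpilkaVolk2018, Lemma 53 (seq.) = ToC Lemma 6.4, p. 31 ("m = r log s + r log r")]
locator: HOME/lit/pdftxt/FSV2018/p028.txt:L17 -/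
theorem factorial_mul_pow_le_two_pow_bmsK {k r s : ℕ} (hk : k ≤ r) :
    k.factorial * s ^ k ≤ 2 ^ bmsK r s := by
  have h1 : k.factorial ≤ 2 ^ (r * Nat.clog 2 r) :=
    calc k.factorial ≤ r.factorial := Nat.factorial_le hk
      _ ≤ r ^ r := Nat.factorial_le_pow r
      _ ≤ (2 ^ Nat.clog 2 r) ^ r := Nat.pow_le_pow_left (Nat.le_pow_clog one_lt_two r) r
      _ = 2 ^ (r * Nat.clog 2 r) := by rw [← pow_mul, mul_comm]
  have h2 : s ^ k ≤ 2 ^ (r * Nat.clog 2 s) :=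
    calc s ^ k ≤ (2 ^ Nat.clog 2 s) ^ k := Nat.pow_le_pow_left (Nat.le_pow_clog one_lt_two s) k
      _ ≤ (2 ^ Nat.clog 2 s) ^ r := Nat.pow_le_pow_right Nat.one_le_two_pow hk
      _ = 2 ^ (r * Nat.clog 2 s) := by rw [← pow_mul, mul_comm]
  calc k.factorial * s ^ k ≤ 2 ^ (r * Nat.clog 2 r) * 2 ^ (r * Nat.clog 2 s) :=
        Nat.mul_le_mul h1 h2
    _ = 2 ^ bmsK r s := by rw [← pow_add, bmsK, add_comm]

end Sparsity

/-! ### Rank: a ring map that kills no relevant minor preserves the rank of a matrix -/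

section Rank

/-- **Rank preservation by minors.** Let `J` be a matrix over a commutative ring `A`,
`ι : A → K` an injective ring map into a field (here: `𝔽[X] ⊆ 𝔽(X)`) and `φ : A → L` a ring map
into a field (here: `𝔽[X] → 𝔽[z] ⊆ 𝔽(z)`, the substitution of a generator). If `φ` does not kill any
non-vanishing `k × k` minor of `J` with `k ≤ rank_K J`, then `rank_L φ(J) = rank_K J` (the rank of a
matrix over a field is the largest size of a non-vanishing minor:
`Literature.LinearAlgebra.Matrix.le_rank_iff_exists_det_submatrix_ne_zero`, and minors commute
with ring maps, `RingHom.map_det`). This is the shape of "the map … preserves the rank of the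
Jacobian matrix … from the fact that each `r × r` minor … and from Corollary 5.10".
[cite: ForbesShpilkaVolk2018, proof of Lemma 53 (seq.) = ToC Lemma 6.4, p. 31]
locator: HOME/lit/pdftxt/FSV2018/p028.txt:L28–L32 -/
theorem rank_map_eq_of_map_minors_ne_zero {A K L : Type*} [CommRing A] [Field K] [Field L]
    {m n : Type*} [Fintype m] [Fintype n] (J : Matrix m n A) (ι : A →+* K)
    (hι : Function.Injective ι) (φ : A →+* L)
    (hφ : ∀ (k : ℕ) (r : Fin k → m) (c : Fin k → n), k ≤ (J.map ι).rank →
      (J.submatrix r c).det ≠ 0 → φ (J.submatrix r c).det ≠ 0) :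
    (J.map φ).rank = (J.map ι).rank := by
  classical
  apply le_antisymm
  · refine Literature.LinearAlgebra.Matrix.rank_le_of_det_submatrix_eq_zero _ fun r c => ?_
    rw [Matrix.submatrix_map, ← RingHom.mapMatrix_apply, ← RingHom.map_det]
    have h0 : (J.submatrix r c).det = 0 := by
      apply hι
      rw [map_zero, RingHom.map_det, RingHom.mapMatrix_apply, ← Matrix.submatrix_map]
      exact Literature.LinearAlgebra.Matrix.det_submatrix_eq_zero_of_rank_lt_card _ r c (by simp)
    rw [h0, map_zero]
  · obtain ⟨r, c, hne⟩ :=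
      (Literature.LinearAlgebra.Matrix.le_rank_iff_exists_det_submatrix_ne_zero (J.map ι)).1 le_rfl
    rw [Matrix.submatrix_map, ← RingHom.mapMatrix_apply, ← RingHom.map_det] at hne
    have hne' : (J.submatrix r c).det ≠ 0 := fun h => hne (by rw [h, map_zero])
    refine (Literature.LinearAlgebra.Matrix.le_rank_iff_exists_det_submatrix_ne_zero
      (J.map φ)).2 ⟨r, c, ?_⟩
    rw [Matrix.submatrix_map, ← RingHom.mapMatrix_apply, ← RingHom.map_det]
    exact hφ _ r c le_rfl hne'

end Rank

/-! ### Index: the binary enumeration of the `N = 2ⁿ` coordinates has `binIndex = index + 1` -/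

section Index

variable {n : ℕ}

/-- The exponent vector of the `k`-th coordinate in the binary order has `i`-th entry the `i`-th
binary digit of `k`. [cite: ForbesShpilkaVolk2018, §7 ("using the binary representation")] -/
theorem coe_binaryOrder_apply (k : Fin (2 ^ n)) (i : Fin n) :
    (((binaryOrder n) k : multilinearMonomials n) : Fin n →₀ ℕ) i =
      ((finFunctionFinEquiv.symm k) i : ℕ) := by
  simp [binaryOrder, multilinearEquivBits]

/-- **`binIndex ∘ binaryOrder = (· + 1)`:** the paper's identification "`i - 1 = Σ_{k ∈ S} 2^{k-1}`"
of `[N]` with subsets of `[n]` (proof of Prop. 17) is the binary order of §7; so Prop. 17's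
Vandermonde exponent `i·j` at the coordinate `binaryOrder n k` is `(k+1)·j`.
[cite: ForbesShpilkaVolk2018, Prop. 17 (seq.) = ToC Prop. 4.2 (proof), p. 21] -/
theorem binIndex_binaryOrder (k : Fin (2 ^ n)) :
    binIndex (((binaryOrder n) k : multilinearMonomials n) : Fin n →₀ ℕ) = (k : ℕ) + 1 := by
  classical
  set m : Fin n →₀ ℕ := (((binaryOrder n) k : multilinearMonomials n) : Fin n →₀ ℕ) with hm
  set g : Fin n → Fin 2 := finFunctionFinEquiv.symm k with hg
  have hcoe : ∀ i, m i = (g i : ℕ) := fun i => by rw [hm, hg]; exact coe_binaryOrder_apply k i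
  have hk : (k : ℕ) = ∑ i : Fin n, (g i : ℕ) * 2 ^ (i : ℕ) := by
    have : k = finFunctionFinEquiv g := by rw [hg, Equiv.apply_symm_apply]
    conv_lhs => rw [this]
    exact finFunctionFinEquiv_apply g
  rw [binIndex, hk, add_comm]
  congr 1
  calc ∑ i ∈ m.support, 2 ^ (i : ℕ) = ∑ i ∈ m.support, (g i : ℕ) * 2 ^ (i : ℕ) := by
        refine Finset.sum_congr rfl fun i hi => ?_
        have h1 : m i ≠ 0 := Finsupp.mem_support_iff.1 hi
        have h2 : (g i : ℕ) < 2 := (g i).2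
        rw [hcoe] at h1
        have h3 : (g i : ℕ) = 1 := by omega
        rw [h3, one_mul]
    _ = ∑ i, (g i : ℕ) * 2 ^ (i : ℕ) := by
        refine Finset.sum_subset (Finset.subset_univ _) fun i _ hi => ?_
        have h1 : m i = 0 := Finsupp.notMem_support_iff.1 hi
        rw [hcoe] at h1
        rw [h1, zero_mul]

end Index

/-! ### Substitution: Prop. 17 on the rank-condenser block, a renaming on the SV block -/

section Theta

variable {F : Type*} [CommRing F] {n : ℕ}

/-- Lemma 52's Vandermonde block `Σ_{j=1}^r s_j t^{ij}` at the coordinate `i = k + 1` of the binary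
order is Prop. 17's rank condenser `vdmGenCoeff` (seed variables moved to the `Sum.inr` block of
Lemma 52's target ring). [cite: ForbesShpilkaVolk2018, Prop. 17 and Lemma 52 (seq.) = ToC Prop. 4.2 / Lemma 6.3] -/
theorem rename_inr_vdmGenCoeff_binaryOrder {M' : ℕ} (r : ℕ) (k : Fin (2 ^ n)) :
    rename (Sum.inr : Fin r ⊕ Unit → Fin M' ⊕ (Fin r ⊕ Unit))
        (vdmGenCoeff F n r (((binaryOrder n) k : multilinearMonomials n) : Fin n →₀ ℕ)) =
      ∑ j : Fin r, (X (Sum.inr (Sum.inl j)) : MvPolynomial (Fin M' ⊕ (Fin r ⊕ Unit)) F) *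
        X (Sum.inr (Sum.inr ())) ^ (((k : ℕ) + 1) * ((j : ℕ) + 1)) := by
  rw [vdmGenCoeff, map_sum]
  refine Finset.sum_congr rfl fun j _ => ?_
  rw [map_mul, map_pow, rename_X, rename_X, binIndex_binaryOrder, mul_comm ((j : ℕ) + 1)]

/-- Substituting variables for variables is renaming. [folklore] -/
private theorem bind₁_X_comp_eq_rename {σ τ : Type*} (f : σ → τ) (p : MvPolynomial σ F) :
    bind₁ (fun w => (X (f w) : MvPolynomial τ F)) p = rename f p := by
  have h : bind₁ (fun w => (X (f w) : MvPolynomial τ F)) = rename f :=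
    algHom_ext fun i => by rw [bind₁_X_right, rename_X]
  rw [h]

/-- **The substitution `θ` used to specialise `𝒢^{BMS}`**: Prop. 17's binary powers
`t_0 ↦ t, t_k ↦ t^{2^{k-1}}` on the rank-condenser seeds (landing in Lemma 52's `(s, t)` block
`Sum.inr`) and a renaming `eτ` of the SV seeds (landing in Lemma 52's `z` block `Sum.inl`). On an
output of `𝒢^{BMS}_{r,s} = 𝒢^{RC}_{n,r} + 𝒢^{SSSV}_{n,m}` it gives "Vandermonde + renamed SV"
("by … Proposition 4.2", the `𝒢^{RC}` half of the printed proof).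
[cite: ForbesShpilkaVolk2018, proof of Lemma 53 (seq.) = ToC Lemma 6.4, p. 31]
locator: HOME/lit/pdftxt/FSV2018/p028.txt:L28 -/
theorem bind₁_theta_bmsGenCoeff {M' : ℕ} (r s : ℕ)
    (eτ : Fin (bmsK r s) ⊕ (Fin (bmsK r s) × Fin n) → Fin M') (m : Fin n →₀ ℕ) :
    bind₁ (Sum.elim
        (fun v => rename (Sum.inr : Fin r ⊕ Unit → Fin M' ⊕ (Fin r ⊕ Unit))
          (binaryPowersSubst F n r v))
        (fun w => (X (Sum.inl (eτ w)) : MvPolynomial (Fin M' ⊕ (Fin r ⊕ Unit)) F)))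
        (bmsGenCoeff F n r s m) =
      rename Sum.inr (vdmGenCoeff F n r m) +
        rename (Sum.inl ∘ eτ) (svGenCoeff F n (bmsK r s) m) := by
  rw [bmsGenCoeff, map_add, bind₁_rename, bind₁_rename, Sum.elim_comp_inl, Sum.elim_comp_inr,
    ← bind₁_binaryPowersSubst_rcGenCoeff, rename_bind₁]
  exact congrArg _ (bind₁_X_comp_eq_rename _ _)

/-- `θ ∘ 𝒢^{BMS}_{r,s}` at the `k`-th coordinate of the binary order is exactly Lemma 52's map
`Ψ : X_k ↦ Σ_j s_j t^{(k+1)j} + Φ(X_k)` with `Φ(X_k)` = the renamed `k`-th coordinate of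
`𝒢^{SSSV}_{n,m}` ("By Lemma 6.3 and Proposition 4.2, it is enough to show …").
[cite: ForbesShpilkaVolk2018, proof of Lemma 53 (seq.) = ToC Lemma 6.4, p. 31]
locator: HOME/lit/pdftxt/FSV2018/p028.txt:L28 -/
theorem bind₁_theta_bmsGenCoeff_binaryOrder {M' : ℕ} (r s : ℕ)
    (eτ : Fin (bmsK r s) ⊕ (Fin (bmsK r s) × Fin n) → Fin M') (k : Fin (2 ^ n)) :
    bind₁ (Sum.elim
        (fun v => rename (Sum.inr : Fin r ⊕ Unit → Fin M' ⊕ (Fin r ⊕ Unit))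
          (binaryPowersSubst F n r v))
        (fun w => (X (Sum.inl (eτ w)) : MvPolynomial (Fin M' ⊕ (Fin r ⊕ Unit)) F)))
        (bmsGenCoeff F n r s (((binaryOrder n) k : multilinearMonomials n) : Fin n →₀ ℕ)) =
      (∑ j : Fin r, (X (Sum.inr (Sum.inl j)) : MvPolynomial (Fin M' ⊕ (Fin r ⊕ Unit)) F) *
          X (Sum.inr (Sum.inr ())) ^ (((k : ℕ) + 1) * ((j : ℕ) + 1))) +
        rename Sum.inl (rename eτ
          (svGenCoeff F n (bmsK r s) (((binaryOrder n) k : multilinearMonomials n) : Fin n →₀ ℕ))) := by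
  rw [bind₁_theta_bmsGenCoeff, rename_inr_vdmGenCoeff_binaryOrder, rename_rename]

end Theta

/-! ### Main: Lemma 53 (hitting half) from Fact 51 and Lemma 52 -/

section Main

open Literature.Algebra.Polynomial.JacobianCriterion

variable {F : Type*} [Field F]

/-- **The printed proof of Lemma 53, over the `N = 2ⁿ` coordinates enumerated by `Fin (2ⁿ)`.**
For `F_1, …, F_M` of sparsity `≤ s`, degree `≤ d`, `trdeg ≤ r` (`char = 0` or `char > d^r`) and
`C(F_1, …, F_M) ≠ 0`: (i) the transcendence degree `ρ ≤ r` is attained by a maximal algebraically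
independent subfamily and Fact 51 gives `rank Jac = ρ`; (ii) every non-vanishing `k × k` minor of
the Jacobian, `k ≤ ρ ≤ r`, has sparsity `≤ k!·s^k ≤ 2^m` (`card_support_det_le`,
`factorial_mul_pow_le_two_pow_bmsK`), so by Cor. 34 (`ForbesShpilkaVolk2018_svGeneratorHitsSparse_holds`)
the substitution `Φ` of `𝒢^{SSSV}_{n,m}` does not kill it, whence `Φ` "preserves the rank of the
Jacobian matrix" (`rank_map_eq_of_map_minors_ne_zero`); (iii) Lemma 52 then says that
`Ψ : X_k ↦ Σ_j s_j t^{(k+1)j} + Φ(X_k)` keeps `C(F_1, …, F_M)` non-zero.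
[cite: ForbesShpilkaVolk2018, Lemma 53 with proof (seq.) = ToC Lemma 6.4, p. 31]
locator: HOME/lit/pdftxt/FSV2018/p028.txt:L17–L32; HOME/lit/pdftxt/FSV2018-ToC/p031.txt:L29–L45 -/
theorem aeval_psi_ne_zero_of_fact51_of_lemma52
    (h51 : ForbesShpilkaVolk2018_fact51 F) (h52 : ForbesShpilkaVolk2018_lemma52 F)
    {n r s d M : ℕ} (hchar : ringChar F = 0 ∨ d ^ r < ringChar F)
    (Fv : Fin M → MvPolynomial (Fin (2 ^ n)) F) (Cp : MvPolynomial (Fin M) F)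
    (hsp : ∀ i, (Fv i).support.card ≤ s) (hdeg : ∀ i, (Fv i).totalDegree ≤ d)
    (htr : TrdegLE F Fv r) (h0 : aeval Fv Cp ≠ 0) :
    aeval (fun i => aeval (fun k : Fin (2 ^ n) =>
      (∑ j : Fin r, (X (Sum.inr (Sum.inl j)) :
          MvPolynomial (Fin (Fintype.card (Fin (bmsK r s) ⊕ (Fin (bmsK r s) × Fin n))) ⊕
            (Fin r ⊕ Unit)) F) *
          X (Sum.inr (Sum.inr ())) ^ (((k : ℕ) + 1) * ((j : ℕ) + 1))) +
        rename Sum.inl (rename (Fintype.equivFin (Fin (bmsK r s) ⊕ (Fin (bmsK r s) × Fin n)))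
          (svGenCoeff F n (bmsK r s)
            (((binaryOrder n) k : multilinearMonomials n) : Fin n →₀ ℕ)))) (Fv i)) Cp ≠ 0 := by
  classical
  -- the SV seed block, renamed to `Fin M'` as Lemma 52 is typed, and the substitution `Φ`
  let τ := Fin (bmsK r s) ⊕ (Fin (bmsK r s) × Fin n)
  let eτ : τ ≃ Fin (Fintype.card τ) := Fintype.equivFin τ
  let gΦ : Fin (2 ^ n) → MvPolynomial (Fin (Fintype.card τ)) F := fun k =>
    rename eτ (svGenCoeff F n (bmsK r s) (((binaryOrder n) k : multilinearMonomials n) : Fin n →₀ ℕ))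
  let Φ : MvPolynomial (Fin (2 ^ n)) F →ₐ[F] MvPolynomial (Fin (Fintype.card τ)) F := aeval gΦ
  -- (i) a maximal algebraically independent subfamily: its size `ρ = |T|` is the transcendence degree
  obtain ⟨T, hTind, hTmax⟩ : ∃ T : Finset (Fin M), AlgebraicIndependent F (fun i : T => Fv i) ∧
      ∀ S : Finset (Fin M), AlgebraicIndependent F (fun i : S => Fv i) → S.card ≤ T.card := by
    have hne : (Finset.univ.filter fun S : Finset (Fin M) =>
        AlgebraicIndependent F (fun i : S => Fv i)).Nonempty := by
      refine ⟨∅, Finset.mem_filter.2 ⟨Finset.mem_univ _, ?_⟩⟩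
      haveI : IsEmpty (↥(∅ : Finset (Fin M))) := ⟨fun x => Finset.notMem_empty x.1 x.2⟩
      exact algebraicIndependent_empty_type
    obtain ⟨T, hT, hmax⟩ := Finset.exists_max_image _ Finset.card hne
    exact ⟨T, (Finset.mem_filter.1 hT).2,
      fun S hS => hmax S (Finset.mem_filter.2 ⟨Finset.mem_univ _, hS⟩)⟩
  have hρr : T.card ≤ r := htr T hTind
  have htrρ : TrdegLE F Fv T.card := fun S hS => hTmax S hS
  have hcharρ : ringChar F = 0 ∨ d ^ T.card < ringChar F := by
    rcases hchar with h | h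
    · exact Or.inl h
    · right
      rcases Nat.eq_zero_or_pos d with hd | hd
      · subst hd
        have hp : ringChar F ≠ 1 := CharP.ringChar_ne_one
        have h1 : 0 < ringChar F := lt_of_le_of_lt (Nat.zero_le _) h
        calc 0 ^ T.card ≤ 1 ^ T.card := Nat.pow_le_pow_left (Nat.zero_le 1) _
          _ = 1 := one_pow _
          _ < ringChar F := by omega
      · exact (Nat.pow_le_pow_right hd hρr).trans_lt h
  -- Fact 51 [BMS13]: the rank of the Jacobian is the transcendence degree
  have hJ : jacobianRank Fv = T.card := h51 (2 ^ n) M d T.card Fv hdeg htrρ ⟨T, rfl, hTind⟩ hcharρ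
  -- (ii) `Φ` preserves the rank of the Jacobian (sparsity of minors + Cor. 34)
  have hrank : jacobianRank Fv = ((jacobianMatrix Fv).map fun q =>
      algebraMap (MvPolynomial (Fin (Fintype.card τ)) F)
        (FractionRing (MvPolynomial (Fin (Fintype.card τ)) F)) (Φ q)).rank := by
    have hfun : (fun q => algebraMap (MvPolynomial (Fin (Fintype.card τ)) F)
        (FractionRing (MvPolynomial (Fin (Fintype.card τ)) F)) (Φ q)) =
        ⇑((algebraMap (MvPolynomial (Fin (Fintype.card τ)) F)
          (FractionRing (MvPolynomial (Fin (Fintype.card τ)) F))).comp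
            (Φ : MvPolynomial (Fin (2 ^ n)) F →+* MvPolynomial (Fin (Fintype.card τ)) F)) := rfl
    rw [hfun, jacobianRank]
    symm
    refine rank_map_eq_of_map_minors_ne_zero (jacobianMatrix Fv) _ (IsFractionRing.injective _ _)
      _ fun k rr cc hk hne => ?_
    -- `k ≤ rank = ρ ≤ r`
    have hkr : k ≤ r := by
      have hk' : k ≤ jacobianRank Fv := hk
      rw [hJ] at hk'
      exact hk'.trans hρr
    -- "each `k × k` minor … is a polynomial of sparsity at most `k!·s^k`" `≤ 2^m`
    have hμs : ((jacobianMatrix Fv).submatrix rr cc).det.support.card ≤ 2 ^ bmsK r s := by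
      refine (card_support_det_le _ s fun i j => ?_).trans (factorial_mul_pow_le_two_pow_bmsK hkr)
      rw [Matrix.submatrix_apply, jacobianMatrix_apply]
      exact (card_support_pderiv_le _ _).trans (hsp _)
    -- Cor. 34: the shifted SV generator with `m` seed blocks does not kill a `2^m`-sparse polynomial
    have hμ0 : rename (binaryOrder n) ((jacobianMatrix Fv).submatrix rr cc).det ≠ 0 :=
      (map_ne_zero_iff _ (rename_injective _ (binaryOrder n).injective)).2 hne
    have hμs' : (rename (binaryOrder n) ((jacobianMatrix Fv).submatrix rr cc).det).support.card ≤
        2 ^ bmsK r s := by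
      rw [support_rename_of_injective (binaryOrder n).injective,
        Finset.card_image_of_injective _ (Finsupp.mapDomain_injective (binaryOrder n).injective)]
      exact hμs
    have h34 := ForbesShpilkaVolk2018_svGeneratorHitsSparse_holds F n (bmsK r s) _ hμ0 hμs'
    rw [bind₁_rename] at h34
    have hΦμ : Φ ((jacobianMatrix Fv).submatrix rr cc).det =
        rename eτ (bind₁ ((fun m : multilinearMonomials n =>
          svGenCoeff F n (bmsK r s) (m : Fin n →₀ ℕ)) ∘ (binaryOrder n))
            ((jacobianMatrix Fv).submatrix rr cc).det) := by
      rw [rename_bind₁]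
      rfl
    change algebraMap _ _ (Φ ((jacobianMatrix Fv).submatrix rr cc).det) ≠ 0
    rw [map_ne_zero_iff _ (IsFractionRing.injective _ _), hΦμ]
    exact (map_ne_zero_iff _ (rename_injective _ eτ.injective)).2 h34
  -- (iii) Lemma 52 [ASSS16]
  have hΨ := (h52 (2 ^ n) M (Fintype.card τ) d r Fv Cp Φ hdeg htr hchar hrank).1 h0
  simpa only [Φ, gΦ, aeval_X] using hΨ

end Main

end FSV18Lemma53

/-! ### The named fact `ForbesShpilkaVolk2018_lemma53` modulo Fact 51 and Lemma 52 -/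

section Headline

open FSV18Lemma53

variable {F : Type*} [Field F]

/-- **FSV Lemma 53 (ToC Lemma 6.4), hitting half — the named fact
`ForbesShpilkaVolk2018_lemma53`, PROVED modulo Fact 51 [BMS13] and Lemma 52 [ASSS16]** (the two
external results its printed proof quotes; both are the cell's named facts, stated in the
corrected strict-characteristic form). The printed proof: transport the data to the `N = 2ⁿ`
coordinates in the binary order; if `G ∘ 𝒢^{BMS}_{r,s} ≡ 0` then applying the substitution `θ`
(Prop. 17's binary powers on the `𝒢^{RC}` seeds, a renaming on the `𝒢^{SSSV}` seeds) gives
`G ∘ Ψ ≡ 0` for Lemma 52's `Ψ` (`bind₁_theta_bmsGenCoeff_binaryOrder`), contradicting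
`aeval_psi_ne_zero_of_fact51_of_lemma52`.
[cite: ForbesShpilkaVolk2018, Lemma 53 (seq.) = ToC Lemma 6.4, p. 31]
locator: HOME/lit/pdftxt/FSV2018/p028.txt:L17–L32; HOME/lit/pdftxt/FSV2018-ToC/p031.txt:L29–L45 -/
theorem ForbesShpilkaVolk2018_lemma53_of_fact51_of_lemma52
    (h51 : ForbesShpilkaVolk2018_fact51 F) (h52 : ForbesShpilkaVolk2018_lemma52 F) :
    ForbesShpilkaVolk2018_lemma53 F := by
  classical
  intro n r s d hchar D hD hD0 hcomp
  obtain ⟨M, G, Cp, hG, htr, rfl⟩ := hD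
  -- the data over the `N = 2ⁿ` coordinates `Fin (2ⁿ)` (binary order)
  have hsp : ∀ i, (rename (binaryOrder n).symm (G i)).support.card ≤ s := fun i => by
    rw [support_rename_of_injective (binaryOrder n).symm.injective,
      Finset.card_image_of_injective _
        (Finsupp.mapDomain_injective (binaryOrder n).symm.injective)]
    exact (hG i).1
  have hdeg : ∀ i, (rename (binaryOrder n).symm (G i)).totalDegree ≤ d := fun i =>
    (totalDegree_rename_le _ _).trans (hG i).2
  have htr' : TrdegLE F (fun i => rename (binaryOrder n).symm (G i)) r := fun S hS =>
    htr S (AlgebraicIndependent.of_comp (rename (binaryOrder n).symm) hS)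
  have h0 : aeval (fun i => rename (binaryOrder n).symm (G i)) Cp ≠ 0 := by
    rw [← comp_aeval_apply]
    exact (map_ne_zero_iff _ (rename_injective _ (binaryOrder n).symm.injective)).2 hD0
  refine aeval_psi_ne_zero_of_fact51_of_lemma52 h51 h52 hchar _ Cp hsp hdeg htr' h0 ?_
  -- apply `θ` to `G ∘ 𝒢^{BMS} = 0`
  have hθ := congrArg (bind₁ (Sum.elim
      (fun v => rename (Sum.inr : Fin r ⊕ Unit →
        Fin (Fintype.card (Fin (bmsK r s) ⊕ (Fin (bmsK r s) × Fin n))) ⊕ (Fin r ⊕ Unit))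
          (binaryPowersSubst F n r v))
      (fun w => (X (Sum.inl ((Fintype.equivFin (Fin (bmsK r s) ⊕ (Fin (bmsK r s) × Fin n))) w)) :
        MvPolynomial (Fin (Fintype.card (Fin (bmsK r s) ⊕ (Fin (bmsK r s) × Fin n))) ⊕
          (Fin r ⊕ Unit)) F)))) hcomp
  rw [map_zero, bind₁_bind₁] at hθ
  rw [← hθ, comp_aeval_apply]
  refine congrArg (fun g => aeval g Cp) (funext fun i => ?_)
  rw [aeval_rename]
  refine congrArg (fun g => aeval g (G i)) (funext fun m => ?_)
  obtain ⟨k, rfl⟩ := (binaryOrder n).surjective m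
  rw [Function.comp_apply, Equiv.symm_apply_apply, bind₁_theta_bmsGenCoeff_binaryOrder]

/-- Pointwise-in-`F` packaging for the assembly files (which take `∀ F, …` hypotheses).
[cite: ForbesShpilkaVolk2018, Lemma 53 (seq.) = ToC Lemma 6.4, p. 31] -/
theorem ForbesShpilkaVolk2018_lemma53_of_facts
    (h51 : ∀ (F : Type) [Field F], ForbesShpilkaVolk2018_fact51 F)
    (h52 : ∀ (F : Type) [Field F], ForbesShpilkaVolk2018_lemma52 F) :
    ∀ (F : Type) [Field F], ForbesShpilkaVolk2018_lemma53 F :=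
  fun F _ => ForbesShpilkaVolk2018_lemma53_of_fact51_of_lemma52 (h51 F) (h52 F)

end Headline

/-! ### Assembly: the LOAD-BEARING Thm. 9 from EXTERNAL printed results only -/

/-- **FSV Thm. 9 (ToC Thm. 1.10; the LOAD-BEARING `FSV2018_thm9`) from external published results
only:** Fact 19 [SY10/SS rank bounds], Lemma 23 [BMS13/ASSS16], Lemma 36 [Forbes15], Lemma 40
[FSS14, Thm. 4.1], Thm. 48 [ASSS16, Thm. 1.2], Fact 51 [BMS13, Jacobian criterion] and Lemma 52
[ASSS16, faithful-map recipe] — the FSV-internal steps Thm. 43 ⇐ Lemma 40, Cor. 49 ⇐ Thm. 48,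
§6 bullet ⇐ Lemma 53 and (here) Lemma 53 ⇐ Fact 51 + Lemma 52 being kernel-checked
(`FSV2018_thm9_of_R1facts` ∘ `ForbesShpilkaVolk2018_lemma53_of_fact51_of_lemma52`).
[cite: ForbesShpilkaVolk2018, Thm. 9 (seq.) = ToC Thm. 1.10, pp. 14–15]
locator: paper:arxiv-1701.05328 p0011.txt:L1–L16 -/
theorem FSV2018_thm9_of_externalFacts (h19 : FSV2018_fact19) (h23 : FSV2018_lemma23)
    (h36 : FSV2018_lemma36) (h40 : FSV2018_lemma40) (h48 : FSV2018_thm48)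
    (h51 : ∀ (F : Type) [Field F], ForbesShpilkaVolk2018_fact51 F)
    (h52 : ∀ (F : Type) [Field F], ForbesShpilkaVolk2018_lemma52 F) : FSV2018_thm9 :=
  FSV2018_thm9_of_R1facts h19 h23 h36 h40 h48
    (ForbesShpilkaVolk2018_lemma53_of_facts h51 h52)

/-- **FSV Thm. 9 (ToC Thm. 1.10; the LOAD-BEARING `FSV2018_thm9`) from SIX external published
results:** Fact 19 [SY10/SS], Lemma 23 [BMS13/ASSS16], Lemma 36 [Forbes15], Lemma 40 [FSS14,
Thm. 4.1], Thm. 48 [ASSS16, Thm. 1.2] and Lemma 52 [ASSS16] — Lemma 53 being supplied by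
`ForbesShpilkaVolk2018_lemma53_of_lemma52` (`FSV18Lemma53Reduction.lean`, val-lit t21 g2: the printed
proof of Lemma 6.4 with `rank Jac ≤ trdeg` proved outright in every characteristic, so that the
Jacobian criterion Fact 51 is not an input). This is the N1 conditional set with every FSV-internal
step kernel-checked. [cite: ForbesShpilkaVolk2018, Thm. 9 (seq.) = ToC Thm. 1.10, pp. 14–15]
locator: paper:arxiv-1701.05328 p0011.txt:L1–L16 -/
theorem FSV2018_thm9_of_sixExternalFacts (h19 : FSV2018_fact19) (h23 : FSV2018_lemma23)
    (h36 : FSV2018_lemma36) (h40 : FSV2018_lemma40) (h48 : FSV2018_thm48)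
    (h52 : ∀ (F : Type) [Field F], ForbesShpilkaVolk2018_lemma52 F) : FSV2018_thm9 :=
  FSV2018_thm9_of_R1facts h19 h23 h36 h40 h48 fun F _ =>
    ForbesShpilkaVolk2018_lemma53_of_lemma52 (h52 F)

end Literature.Computability.AlgebraicComplexity

end
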